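import Mathlib
import HarnessLib

/-! # NumberPhaseSandwich · bump calculus, part 1 of 3 — the one-dimensional profile `σ`, `τ`

Helper toward the registered stub `stub_nearPivot_of_kinematic` (line «kinematic-near-pivot», crux `FluctuationFloor`,
stmt-AtomisticToContinuum-32638, route NumberPhaseSandwich; decomp-a2c lens-6 g10, LAND ASK-6; split at 400 lines by the landing seat).
The profile `σ = Real.smoothTransition`: explicit `σ′` (`hasDerivAt_smoothTransition`), `σ′ ≥ 0`, `σ′ > 0` on `(0,1)`, a uniform lower
bound of `σ′` on `[1/4,3/4]`, `σ′ = σ″ = 0` off `[0,1]`, global bounds on `|σ′|`, `|σ″|`; the coordinate profile `τ(t) = σ(4t)σ(4(1−t))`,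
`τ′`, `|τ′| ≤ 8C_σ`, `τ″` bounded and `= 0` off `[0,1]`, `τ = 1` on `[1/4,3/4]`. Parts 2/3: `NumberPhaseSandwichBumpCalculus` (the 3-D cell
bumps) and `NumberPhaseSandwichBumpNBody` (pointwise N-body bounds for `g = h_c − h_c'`). Mathlib only; no sorry. -/

noncomputable section

namespace Summit.AtomisticToContinuum.BoseEinsteinCondensation.Theorems.NumberPhaseSandwichBumpProfile

open Real Set Filter Topology


/-- the explicit derivative of `σ`. -/
def sigmaDeriv (x : ℝ) : ℝ :=
  expNegInvGlue x * expNegInvGlue (1 - x) * (x⁻¹ ^ 2 + (1 - x)⁻¹ ^ 2) /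
    (expNegInvGlue x + expNegInvGlue (1 - x)) ^ 2

/-- `σ = Real.smoothTransition` has derivative `sigmaDeriv`. -/
theorem hasDerivAt_smoothTransition (x : ℝ) : HasDerivAt Real.smoothTransition (sigmaDeriv x) x := by
  -- `expNegInvGlue′(y) = y⁻² expNegInvGlue y` (the `p = 1` case of `hasDerivAt_polynomial_eval_inv_mul`; folklore, inlined)
  have hd : ∀ y : ℝ, HasDerivAt expNegInvGlue (y⁻¹ ^ 2 * expNegInvGlue y) y := fun y => by
    have h := expNegInvGlue.hasDerivAt_polynomial_eval_inv_mul 1 y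
    simp only [Polynomial.eval_one, one_mul, Polynomial.derivative_one, sub_zero, mul_one,
      Polynomial.eval_pow, Polynomial.eval_X] at h
    exact h
  have hf := hd x
  have hg : HasDerivAt (fun y => expNegInvGlue (1 - y)) ((1 - x)⁻¹ ^ 2 * expNegInvGlue (1 - x) * (-1)) x := by
    have h1 : HasDerivAt (fun y : ℝ => 1 - y) (-1) x := by
      simpa using (hasDerivAt_id x).const_sub 1
    exact (hd (1 - x)).comp x h1
  have hden := hf.add hg
  have hne : expNegInvGlue x + expNegInvGlue (1 - x) ≠ 0 := (Real.smoothTransition.pos_denom x).ne'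
  have h := hf.div hden hne
  have heq : (expNegInvGlue / (expNegInvGlue + fun y => expNegInvGlue (1 - y))) = Real.smoothTransition := by
    funext y; rfl
  rw [heq] at h
  refine h.congr_deriv ?_
  unfold sigmaDeriv
  simp only [Pi.add_apply]
  field_simp
  ring

/-- `deriv σ x = sigmaDeriv x`. -/
theorem deriv_smoothTransition (x : ℝ) : deriv Real.smoothTransition x = sigmaDeriv x :=
  (hasDerivAt_smoothTransition x).deriv

/-- `deriv σ = sigmaDeriv` as functions. -/
theorem deriv_smoothTransition_eq : deriv Real.smoothTransition = sigmaDeriv :=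
  funext deriv_smoothTransition

/-- `σ′ ≥ 0`. -/
theorem sigmaDeriv_nonneg (x : ℝ) : 0 ≤ sigmaDeriv x := by
  unfold sigmaDeriv
  have := expNegInvGlue.nonneg x
  have := expNegInvGlue.nonneg (1 - x)
  positivity

/-- `σ′ > 0` on `(0,1)`. -/
theorem sigmaDeriv_pos {x : ℝ} (h0 : 0 < x) (h1 : x < 1) : 0 < sigmaDeriv x := by
  unfold sigmaDeriv
  have hfx := expNegInvGlue.pos_of_pos h0
  have hf1 := expNegInvGlue.pos_of_pos (sub_pos.2 h1)
  have hx2 : 0 < x⁻¹ ^ 2 + (1 - x)⁻¹ ^ 2 := by positivity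
  positivity

/-- `σ′ = 0` off `[0,1]` (indeed off `(0,1)`). -/
theorem sigmaDeriv_eq_zero_of_nonpos {x : ℝ} (hx : x ≤ 0) : sigmaDeriv x = 0 := by
  simp [sigmaDeriv, expNegInvGlue.zero_of_nonpos hx]

/-- `σ′ = 0` on `[1, ∞)`. -/
theorem sigmaDeriv_eq_zero_of_one_le {x : ℝ} (hx : 1 ≤ x) : sigmaDeriv x = 0 := by
  simp [sigmaDeriv, expNegInvGlue.zero_of_nonpos (sub_nonpos.2 hx)]

/-- `σ′` is continuous. -/
theorem continuous_sigmaDeriv : Continuous sigmaDeriv := by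
  rw [← deriv_smoothTransition_eq]
  exact (Real.smoothTransition.contDiff (n := 1)).continuous_deriv le_rfl

/-- UNIFORM LOWER BOUND of `σ′` on `[1/4, 3/4]`. -/
theorem exists_sigmaDeriv_lower : ∃ c : ℝ, 0 < c ∧ ∀ x ∈ Icc (1 / 4 : ℝ) (3 / 4), c ≤ sigmaDeriv x := by
  obtain ⟨x₀, hx₀, hmin⟩ := (isCompact_Icc (a := (1 / 4 : ℝ)) (b := 3 / 4)).exists_isMinOn
    (nonempty_Icc.2 (by norm_num)) continuous_sigmaDeriv.continuousOn
  refine ⟨sigmaDeriv x₀, sigmaDeriv_pos (by linarith [hx₀.1]) (by linarith [hx₀.2]), fun x hx => ?_⟩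
  exact hmin hx

/-- GLOBAL BOUND on `|σ′|`. -/
theorem exists_sigmaDeriv_upper : ∃ C : ℝ, 0 < C ∧ ∀ x : ℝ, |sigmaDeriv x| ≤ C := by
  obtain ⟨C, hC⟩ := (isCompact_Icc (a := (0 : ℝ)) (b := 1)).exists_bound_of_continuousOn
    continuous_sigmaDeriv.continuousOn
  refine ⟨max C 1, lt_max_of_lt_right one_pos, fun x => ?_⟩
  by_cases hx : x ∈ Icc (0 : ℝ) 1
  · exact (hC x hx).trans (le_max_left _ _)
  · rw [mem_Icc, not_and_or, not_le, not_le] at hx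
    rcases hx with hx | hx
    · rw [sigmaDeriv_eq_zero_of_nonpos hx.le, abs_zero]; positivity
    · rw [sigmaDeriv_eq_zero_of_one_le hx.le, abs_zero]; positivity

/-- `σ″` is continuous. -/
theorem continuous_deriv_sigmaDeriv : Continuous (deriv sigmaDeriv) := by
  have h : deriv sigmaDeriv = iteratedDeriv 2 Real.smoothTransition := by
    rw [← deriv_smoothTransition_eq, iteratedDeriv_succ, iteratedDeriv_one]
  rw [h]
  exact (Real.smoothTransition.contDiff (n := 2)).continuous_iteratedDeriv 2 le_rfl

/-- `σ″ = 0` off `[0,1]`. -/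
theorem deriv_sigmaDeriv_eq_zero_of_neg {x : ℝ} (hx : x < 0) : deriv sigmaDeriv x = 0 := by
  have h : sigmaDeriv =ᶠ[𝓝 x] fun _ => (0 : ℝ) := by
    filter_upwards [gt_mem_nhds hx] with y hy
    exact sigmaDeriv_eq_zero_of_nonpos hy.le
  rw [h.deriv_eq, deriv_const]

/-- `σ″ = 0` on `(1, ∞)`. -/
theorem deriv_sigmaDeriv_eq_zero_of_one_lt {x : ℝ} (hx : 1 < x) : deriv sigmaDeriv x = 0 := by
  have h : sigmaDeriv =ᶠ[𝓝 x] fun _ => (0 : ℝ) := by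
    filter_upwards [lt_mem_nhds hx] with y hy
    exact sigmaDeriv_eq_zero_of_one_le hy.le
  rw [h.deriv_eq, deriv_const]

/-- GLOBAL BOUND on `|σ″|`. -/
theorem exists_deriv_sigmaDeriv_upper : ∃ C : ℝ, 0 < C ∧ ∀ x : ℝ, |deriv sigmaDeriv x| ≤ C := by
  obtain ⟨C, hC⟩ := (isCompact_Icc (a := (0 : ℝ)) (b := 1)).exists_bound_of_continuousOn
    continuous_deriv_sigmaDeriv.continuousOn
  refine ⟨max C 1, lt_max_of_lt_right one_pos, fun x => ?_⟩
  by_cases hx : x ∈ Icc (0 : ℝ) 1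
  · exact (hC x hx).trans (le_max_left _ _)
  · rw [mem_Icc, not_and_or, not_le, not_le] at hx
    rcases hx with hx | hx
    · rw [deriv_sigmaDeriv_eq_zero_of_neg hx, abs_zero]; positivity
    · rw [deriv_sigmaDeriv_eq_zero_of_one_lt hx, abs_zero]; positivity

/-- `σ(4(1−t)) = 1` for `t ≤ 3/4`: the second bump factor is `≡ 1` there (and `σ(4t) = 1` for `t ≥ 1/4` is
`Real.smoothTransition.one_of_one_le`). -/
theorem smoothTransition_four_mul_one_sub_eq_one {t : ℝ} (ht : t ≤ 3 / 4) :
    Real.smoothTransition (4 * (1 - t)) = 1 :=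
  Real.smoothTransition.one_of_one_le (by linarith)

/-- the transition profile `τ(t) = σ(4t)·σ(4(1−t))` of one coordinate and its derivative. -/
def tau (t : ℝ) : ℝ := Real.smoothTransition (4 * t) * Real.smoothTransition (4 * (1 - t))

/-- the explicit derivative of `τ`. -/
def tauDeriv (t : ℝ) : ℝ :=
  4 * sigmaDeriv (4 * t) * Real.smoothTransition (4 * (1 - t)) - 4 * Real.smoothTransition (4 * t) * sigmaDeriv (4 * (1 - t))

/-- `τ` has derivative `tauDeriv`. -/
theorem hasDerivAt_tau (t : ℝ) : HasDerivAt tau (tauDeriv t) t := by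
  have h1' := (hasDerivAt_smoothTransition (4 * t)).comp t ((hasDerivAt_id' t).const_mul 4)
  have h1 : HasDerivAt (fun s : ℝ => Real.smoothTransition (4 * s)) (sigmaDeriv (4 * t) * (4 * 1)) t := h1'
  have hl : HasDerivAt (fun s : ℝ => 4 * (1 - s)) (4 * -1) t := ((hasDerivAt_id' t).const_sub 1).const_mul 4
  have h2' := (hasDerivAt_smoothTransition (4 * (1 - t))).comp t hl
  have h2 : HasDerivAt (fun s : ℝ => Real.smoothTransition (4 * (1 - s)))
      (sigmaDeriv (4 * (1 - t)) * (4 * -1)) t := h2'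
  have h := h1.mul h2
  show HasDerivAt (fun s : ℝ => Real.smoothTransition (4 * s) * Real.smoothTransition (4 * (1 - s))) (tauDeriv t) t
  refine h.congr_deriv ?_
  unfold tauDeriv
  ring

/-- `τ ≥ 0`. -/
theorem tau_nonneg (t : ℝ) : 0 ≤ tau t :=
  mul_nonneg (Real.smoothTransition.nonneg _) (Real.smoothTransition.nonneg _)

/-- `τ ≤ 1`. -/
theorem tau_le_one (t : ℝ) : tau t ≤ 1 :=
  mul_le_one₀ (Real.smoothTransition.le_one _) (Real.smoothTransition.nonneg _) (Real.smoothTransition.le_one _)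

/-- on the inner gradient window `t ∈ [1/16, 3/16]`: `τ(t) = σ(4t)` and `τ′(t) = 4σ′(4t) ≥ 4c`. -/
theorem tauDeriv_eq_of_mem {t : ℝ} (ht : t ≤ 3 / 4) : tauDeriv t = 4 * sigmaDeriv (4 * t) := by
  unfold tauDeriv
  rw [smoothTransition_four_mul_one_sub_eq_one ht,
    sigmaDeriv_eq_zero_of_one_le (by linarith : (1 : ℝ) ≤ 4 * (1 - t))]
  ring

/-- `|τ′| ≤ 8C` whenever `|σ′| ≤ C`. -/
theorem abs_tauDeriv_le {C : ℝ} (hC : ∀ x : ℝ, |sigmaDeriv x| ≤ C) (t : ℝ) : |tauDeriv t| ≤ 8 * C := by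
  unfold tauDeriv
  have h1 := hC (4 * t)
  have h2 := hC (4 * (1 - t))
  have hs1 := Real.smoothTransition.nonneg (4 * (1 - t))
  have hs1' := Real.smoothTransition.le_one (4 * (1 - t))
  have hs2 := Real.smoothTransition.nonneg (4 * t)
  have hs2' := Real.smoothTransition.le_one (4 * t)
  have ha : |4 * sigmaDeriv (4 * t) * Real.smoothTransition (4 * (1 - t))| ≤ 4 * C := by
    rw [abs_mul, abs_mul, abs_of_nonneg hs1, abs_of_pos (by norm_num : (0 : ℝ) < 4)]
    nlinarith [abs_nonneg (sigmaDeriv (4 * t))]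
  have hb : |4 * Real.smoothTransition (4 * t) * sigmaDeriv (4 * (1 - t))| ≤ 4 * C := by
    rw [abs_mul, abs_mul, abs_of_nonneg hs2, abs_of_pos (by norm_num : (0 : ℝ) < 4)]
    nlinarith [abs_nonneg (sigmaDeriv (4 * (1 - t)))]
  exact (abs_sub _ _).trans (by linarith)


/-- off the (half-open) cell every gradient component vanishes: `τ(t) = 0` and `τ′(t) = 0` for `t ∉ [0,1)`. -/
theorem tau_eq_zero_of_nonpos {t : ℝ} (ht : t ≤ 0) : tau t = 0 := by
  simp [tau, Real.smoothTransition.zero_of_nonpos (by linarith : 4 * t ≤ 0)]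

/-- `τ = 0` on `[1, ∞)`. -/
theorem tau_eq_zero_of_one_le {t : ℝ} (ht : 1 ≤ t) : tau t = 0 := by
  simp [tau, Real.smoothTransition.zero_of_nonpos (by linarith : 4 * (1 - t) ≤ 0)]

/-- `τ′ = 0` on `(-∞, 0]`. -/
theorem tauDeriv_eq_zero_of_nonpos {t : ℝ} (ht : t ≤ 0) : tauDeriv t = 0 := by
  simp [tauDeriv, Real.smoothTransition.zero_of_nonpos (by linarith : 4 * t ≤ 0),
    sigmaDeriv_eq_zero_of_nonpos (by linarith : 4 * t ≤ 0)]

/-- `τ′ = 0` on `[1, ∞)`. -/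
theorem tauDeriv_eq_zero_of_one_le {t : ℝ} (ht : 1 ≤ t) : tauDeriv t = 0 := by
  simp [tauDeriv, Real.smoothTransition.zero_of_nonpos (by linarith : 4 * (1 - t) ≤ 0),
    sigmaDeriv_eq_zero_of_nonpos (by linarith : 4 * (1 - t) ≤ 0)]


/-- `τ = 1` on `[1/4, 3/4]`. -/
theorem tau_eq_one_of_mem {t : ℝ} (ht : t ∈ Icc (1 / 4 : ℝ) (3 / 4)) : tau t = 1 := by
  rw [tau, Real.smoothTransition.one_of_one_le (by linarith [ht.1] : (1 : ℝ) ≤ 4 * t),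
    smoothTransition_four_mul_one_sub_eq_one ht.2, mul_one]

/-- `τ` is `C^∞`. -/
theorem contDiff_tau {m : ℕ∞} : ContDiff ℝ m tau :=
  (Real.smoothTransition.contDiff.comp (contDiff_const.mul contDiff_id)).mul
    (Real.smoothTransition.contDiff.comp (contDiff_const.mul (contDiff_const.sub contDiff_id)))

/-- `tauDeriv = deriv τ`. -/
theorem tauDeriv_eq_deriv_tau : tauDeriv = deriv tau :=
  funext fun t => ((hasDerivAt_tau t).deriv).symm

/-- `τ′` is differentiable. -/
theorem differentiable_tauDeriv : Differentiable ℝ tauDeriv := by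
  have h := (contDiff_tau (m := 2)).differentiable_iteratedDeriv 1 (by norm_num)
  rw [iteratedDeriv_one] at h
  rw [tauDeriv_eq_deriv_tau]; exact h

/-- `τ′` has derivative `deriv τ′`. -/
theorem hasDerivAt_tauDeriv (t : ℝ) : HasDerivAt tauDeriv (deriv tauDeriv t) t :=
  (differentiable_tauDeriv t).hasDerivAt

/-- `τ″` is continuous. -/
theorem continuous_deriv_tauDeriv : Continuous (deriv tauDeriv) := by
  have h : deriv tauDeriv = iteratedDeriv 2 tau := by
    rw [tauDeriv_eq_deriv_tau, iteratedDeriv_succ, iteratedDeriv_one]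
  rw [h]
  exact (contDiff_tau (m := 2)).continuous_iteratedDeriv 2 le_rfl

/-- `τ″ = 0` on `(-∞, 0]` and on `[1, ∞)` (one-sided uniqueness of derivatives at the endpoints: `τ′ ≡ 0` there). -/
theorem deriv_tauDeriv_eq_zero_of_nonpos {t : ℝ} (ht : t ≤ 0) : deriv tauDeriv t = 0 := by
  have h1 : HasDerivWithinAt tauDeriv (deriv tauDeriv t) (Iic 0) t := (hasDerivAt_tauDeriv t).hasDerivWithinAt
  have h2 : HasDerivWithinAt tauDeriv 0 (Iic 0) t :=
    (hasDerivWithinAt_const t (Iic (0 : ℝ)) (0 : ℝ)).congr (fun y hy => tauDeriv_eq_zero_of_nonpos hy)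
      (tauDeriv_eq_zero_of_nonpos ht)
  exact (uniqueDiffOn_Iic 0 t ht).eq_deriv _ h1 h2

/-- `τ″ = 0` on `[1, ∞)`. -/
theorem deriv_tauDeriv_eq_zero_of_one_le {t : ℝ} (ht : 1 ≤ t) : deriv tauDeriv t = 0 := by
  have h1 : HasDerivWithinAt tauDeriv (deriv tauDeriv t) (Ici 1) t := (hasDerivAt_tauDeriv t).hasDerivWithinAt
  have h2 : HasDerivWithinAt tauDeriv 0 (Ici 1) t :=
    (hasDerivWithinAt_const t (Ici (1 : ℝ)) (0 : ℝ)).congr (fun y hy => tauDeriv_eq_zero_of_one_le hy)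
      (tauDeriv_eq_zero_of_one_le ht)
  exact (uniqueDiffOn_Ici 1 t ht).eq_deriv _ h1 h2

/-- GLOBAL BOUND on `|τ″|`. -/
theorem exists_deriv_tauDeriv_upper : ∃ C : ℝ, 0 < C ∧ ∀ t : ℝ, |deriv tauDeriv t| ≤ C := by
  obtain ⟨C, hC⟩ := (isCompact_Icc (a := (0 : ℝ)) (b := 1)).exists_bound_of_continuousOn
    continuous_deriv_tauDeriv.continuousOn
  refine ⟨max C 1, lt_max_of_lt_right one_pos, fun t => ?_⟩
  by_cases ht : t ∈ Icc (0 : ℝ) 1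
  · exact (hC t ht).trans (le_max_left _ _)
  · rw [mem_Icc, not_and_or, not_le, not_le] at ht
    rcases ht with ht | ht
    · rw [deriv_tauDeriv_eq_zero_of_nonpos ht.le, abs_zero]; positivity
    · rw [deriv_tauDeriv_eq_zero_of_one_le ht.le, abs_zero]; positivity

end Summit.AtomisticToContinuum.BoseEinsteinCondensation.Theorems.NumberPhaseSandwichBumpProfile

end
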